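import Summits.QuantumFields.YangMills.Theorems.UnitScaleTiltProp7CovKernelMemberGen0
import Summits.QuantumFields.YangMills.Theorems.UnitScaleTiltProp7CovKernelTransplantAssembly
import Summits.QuantumFields.YangMills.Theorems.UnitScaleTiltProp7CentrePinnedHessianPoincareCovMember
import Summits.QuantumFields.YangMills.Theorems.UnitScaleTiltProp7TransplantGen1Package
import Summits.QuantumFields.YangMills.Theorems.UnitScaleTiltProp7TransplantGen1Arithmetic
import HarnessLib

/-!
# Route `UnitScaleTilt`, crux K1 «MinimiserStabilityRegPr» (stmt-QuantumFields-19200), route-R E′ path (α′), (E1-b) at the CURVED background — ★★★ THE (A-cov) MEMBER THEOREM: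
# AT EVERY MEMBER OF RECORD (`W ∈ RegPr`, `L·L^{a'}·α₀ ≤ a₅`, px4's (D1-cov) window), THE COVARIANT (hK) ROW `hKsup` OF ★routeR-w3's ✓ `linCorr_gauge_le_of_hKsup` HOLDS WITH `κ := c_K·ℓ_k`:
# for every pinned-biharmonic interpolant `φ_H` of `φ` (equal on the centres `c(T_{K−n})`, `Δ_𝒰Δ_𝒰 φ_H = 0` off them) and every `s₁ ≥ sup_z √hs(Δ_𝒰φ)(z)`,
# `√hs(D_{𝒰,μ}(φ − φ_H))(x) ≤ c_K·ℓ_k·s₁` at every bond — Bałaban's (1.36)∕(3.35) interpolation-error estimate at the unit-lattice member, `c_K` absolute.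

PROOF = ✓p680753 `hKsup_of_transplant_T3'` (duality + pinned covariant biharmonic solve + Agmon-weighted transplant reading) with: `hP` := px4 ✓ `sqrt_sum_hs_le_of_regPr'` (centre-pinned
covariant Hessian–Poincaré, constant `A`), `A ≤ c_A·ℓ_k²` := ✓p683205 `poincare_const_le`, Agmon rate `κ_A := min(1∕4, 1∕(200√3√c_A+1), 1∕(600c_A+1))` ⇒ the three windows; per bond: ✓p684704
`exists_member_gen0_half` (anchored cone frame `Fr`, weight `ω`, gen-0 package `ψ g c₁ c₂ ψt` + five numbers + `Σ₀ ≤ c₀·ℓ_k·√hsX`), routeR-w6 g7 ✓p685561 `exists_gen1_package` on the density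
`E₂` (gen-1 fields `F F′ c₁′ c₂′ J` + numbers), ✓p681947 `htr_body_of_rows'''` (the transplant `V := ψ•R(Fr)X − R(Fr)F` solves `Δ_𝒰²V = dipole + Δ_𝒰h + s` off the centres), px11 g4 ✓p685688
`gen1_total_le` (`Σ₁ ≤ c₁·ℓ_k·(D·ℓ_k²)`) and `D·ℓ_k² ≤ 3(32α+400α²)C₀·√hsX` (✓ `junk_B_le`).  Cell `ym3-torus`, width seat `ym3-torus-px22` (gen 3).  THEOREMS ONLY (0 `def`, 0 `sorry`);
`--supports stmt-QuantumFields-19200`, count-neutral.  YM₃ on T³ is a ladder rung (R3), not the Clay problem; nothing here claims the stub, the crux, d = 4 or the gap.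

References: T. Bałaban, CMP 98 (1985) 17–51 [Balaban1985Variational] (Prop. 7 p.299); CMP 99 (1985) 75–102 [Balaban1985RegularSpaces] ((1.36) p.82); CMP 99 (1985) 389–434
[Balaban1985BackgroundPropagators] ((3.8) p.392, (3.35) p.396); CMP 96 (1984) 223–250 [Balaban1984PropagatorsII] ((1.9) p.226).
-/

set_option autoImplicit false

noncomputable section

open scoped BigOperators Matrix.Norms.L2Operator Matrix
open Finset

namespace Summit.QuantumFields.YangMills.Theorems.Prop7CovKernelMember

open Literature.MathematicalPhysics.QuantumFieldTheory.Balaban1983to89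
open Literature.MathematicalPhysics.QuantumFieldTheory.Balaban1983to89.T3ContinuumYM3Torus
open Literature.MathematicalPhysics.QuantumFieldTheory.Balaban1983to89.T3PrintedRegularMinimiser (RegPr)
open Literature.MathematicalPhysics.QuantumFieldTheory.Balaban1983to89.B6GlobalChartV1 (PV)
open B9Eq39Adjoint (R covD divB)
open B9TorusCalculus (torusT)
open B15DeterminingSets (embIter)
open B10Eq27TorusAxialLog (unitsField toUField)
open Summit.QuantumFields.YangMills.Theorems.Prop7SectET3Members (hd3 hkw)
open Summit.QuantumFields.YangMills.Theorems.Prop7CovKernelMemberGen0 (exists_member_gen0_half)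
open Summit.QuantumFields.YangMills.Theorems.Prop7CovKernelMemberRows (hKsup_of_transplant_T3')
open Summit.QuantumFields.YangMills.Theorems.Prop7CovKernelMemberSizes (poincare_const_le)
open Summit.QuantumFields.YangMills.Theorems.Prop7CovKernelTransplantAssembly (htr_body_of_rows''')
open Summit.QuantumFields.YangMills.Theorems.Prop7CentrePinnedHessianPoincareCovMember (sqrt_sum_hs_le_of_regPr')
open Summit.QuantumFields.YangMills.Theorems.Prop7TransplantGen1Package (exists_gen1_package)
open Summit.QuantumFields.YangMills.Theorems.Prop7TransplantGen1Arithmetic (gen1_total_le)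
open Summit.QuantumFields.YangMills.Theorems.Prop7TransplantGen0Numbers (card_ball_le)
open Summit.QuantumFields.YangMills.Theorems.Prop7TransplantNearDatum (card_ball_le')
open Summit.QuantumFields.YangMills.Theorems.Prop7CovPinJunkSums (norm_le_sqrt_hs)

variable {ℓ : ℕ} {hL : Odd (ℓ + 1) ∧ 1 < ℓ + 1}

/-- `htot` from its two halves: the gen-0 half `N2₀ + N3₀ + W·3N4₀ + W(3H₀ + 5A·S₀) ≤ g₀`, the gen-1 half `N2₁ + W(3H₁ + 5A·S₁) ≤ g₁` (with `Nh = N3₁ = N4₁ = 0`) and `g₀ + g₁ ≤ r`. [folklore] -/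
theorem htot_of_halves {W A r N2₀ N2₁ N3₀ N4₀ H₀ H₁ S₀ S₁ g₀ g₁ : ℝ}
    (h₀ : N2₀ + N3₀ + W * (3 * N4₀) + W * (3 * H₀ + 5 * A * S₀) ≤ g₀) (h₁ : N2₁ + W * (3 * H₁ + 5 * A * S₁) ≤ g₁) (hg : g₀ + g₁ ≤ r) :
    W * (3 * 0) + (N2₀ + N2₁) + (N3₀ + 0) + W * (3 * (N4₀ + 0)) + W * (3 * (H₀ + H₁) + 5 * A * (S₀ + S₁)) ≤ r := by
  have e : W * (3 * 0) + (N2₀ + N2₁) + (N3₀ + 0) + W * (3 * (N4₀ + 0)) + W * (3 * (H₀ + H₁) + 5 * A * (S₀ + S₁))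
      = (N2₀ + N3₀ + W * (3 * N4₀) + W * (3 * H₀ + 5 * A * S₀)) + (N2₁ + W * (3 * H₁ + 5 * A * S₁)) := by ring
  rw [e]; linarith

/-- the sum of the two halves: `c₀·ℓ·r + c₁·ℓ·(Dℓ²) ≤ (c₀ + 3c₁M + 1)·ℓ·r` when `Dℓ² ≤ 3M·r`. [folklore] -/
theorem hg_of {c₀ c₁ M ℓ r Dℓ2 : ℝ} (hc₁ : 0 ≤ c₁) (hℓ : 0 ≤ ℓ) (hr : 0 ≤ r) (hD : Dℓ2 ≤ 3 * M * r) :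
    c₀ * ℓ * r + c₁ * ℓ * Dℓ2 ≤ (c₀ + 3 * c₁ * M + 1) * ℓ * r := by
  have h1 : c₁ * ℓ * Dℓ2 ≤ c₁ * ℓ * (3 * M * r) := mul_le_mul_of_nonneg_left hD (by positivity)
  have e : (c₀ + 3 * c₁ * M + 1) * ℓ * r = c₀ * ℓ * r + c₁ * ℓ * (3 * M * r) + ℓ * r := by ring
  rw [e]
  have h2 : 0 ≤ ℓ * r := by positivity
  linarith

set_option maxHeartbeats 400000 in
/-- ★★★ **THE (A-cov) MEMBER THEOREM** (see the module docstring): in px11's ✓p680458 member binders plus px4's (D1-cov) window, the `hKsup` row of ★routeR-w3's ✓ `linCorr_gauge_le_of_hKsup`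
VERBATIM with `κ := c_K·ℓ_k`, `ℓ_k = (ℓ+1)^{K−n}`, `c_K` absolute. [cite: Balaban1985Variational, Prop. 7 p.299; Balaban1985RegularSpaces, (1.36) p.82; Balaban1985BackgroundPropagators, (3.8) p.392, (3.35) p.396] -/
theorem hKsup_member (hℓ4 : 4 ≤ ℓ) : ∃ c35 a₅ cK : ℝ, 0 < c35 ∧ 0 < a₅ ∧ 0 < cK ∧
    ∀ (hℓ : 4 ≤ ℓ) (m : ℕ) (hm : 1 ≤ m) (n K a' R : ℕ) (hk1 : 1 ≤ K - n) (hsize : a' + 3 ≤ m + n) (hM8 : 8 ≤ (ℓ + 1) ^ a')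
      (hR2 : 2 * (ℓ + 1) ^ 2 ≤ R) (α₀ : ℝ), 0 < α₀ → α₀ ≤ 1 → ((ℓ + 1 : ℕ) : ℝ) * (((ℓ + 1) ^ a' : ℕ) : ℝ) * α₀ ≤ a₅ →
      ∀ W : GaugeField (PV 2 ℓ m K hd3 hL) 0 (Matrix.specialUnitaryGroup (Fin 2) ℂ),
        RegPr (⟨ℓ + 1, hL, m, hm⟩ : T3Family) n K α₀ W →
        (4 * 2197 * (24 * 289 * 24576 * 46116) : ℝ) * ((2 : ℕ) : ℝ) ^ 2 * ((((PV 2 ℓ m K hd3 hL).L : ℝ)) ^ (K - n)) ^ 4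
            * ((((PV 2 ℓ m K hd3 hL).d : ℝ)) ^ 2 * (4 * ((2 : ℕ) : ℝ) * (α₀ * ((((PV 2 ℓ m K hd3 hL).L : ℝ))⁻¹) ^ (2 * (K - n))) ^ 2
              + (2 * ((((ℓ + 1 : ℕ) : ℝ) ^ (K - n))⁻¹ * ((((ℓ + 1 : ℕ) : ℝ) ^ (K - n))⁻¹ * (c35 * (((ℓ + 1 : ℕ) : ℝ) * (((ℓ + 1) ^ a' : ℕ) : ℝ)) * α₀))
                  * Real.exp ((((ℓ + 1 : ℕ) : ℝ) ^ (K - n))⁻¹ * (c35 * (((ℓ + 1 : ℕ) : ℝ) * (((ℓ + 1) ^ a' : ℕ) : ℝ)) * α₀)))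
                + 4 * ((((ℓ + 1 : ℕ) : ℝ) ^ (K - n))⁻¹ * (c35 * (((ℓ + 1 : ℕ) : ℝ) * (((ℓ + 1) ^ a' : ℕ) : ℝ)) * α₀)
                  * Real.exp ((((ℓ + 1 : ℕ) : ℝ) ^ (K - n))⁻¹ * (c35 * (((ℓ + 1 : ℕ) : ℝ) * (((ℓ + 1) ^ a' : ℕ) : ℝ)) * α₀))) ^ 2) ^ 2)) ≤ 1 / 4 →
        ∀ (φ φH : Site (PV 2 ℓ m K hd3 hL) 0 → Matrix (Fin 2) (Fin 2) ℂ),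
          (∀ y : Site (PV 2 ℓ m K hd3 hL) (K - n), φH (embIter (K - n) y) = φ (embIter (K - n) y)) →
          (∀ x : Site (PV 2 ℓ m K hd3 hL) 0, x ∉ Set.range (embIter (K - n)) → divB (torusT (PV 2 ℓ m K hd3 hL) 0) (fun κ z => unitsField (toUField W) ⟨z, κ⟩) (fun μ => covD (torusT (PV 2 ℓ m K hd3 hL) 0) (fun κ z => unitsField (toUField W) ⟨z, κ⟩) μ (fun y => divB (torusT (PV 2 ℓ m K hd3 hL) 0) (fun κ z => unitsField (toUField W) ⟨z, κ⟩) (fun μ => covD (torusT (PV 2 ℓ m K hd3 hL) 0) (fun κ z => unitsField (toUField W) ⟨z, κ⟩) μ φH) y)) x = 0) →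
          ∀ s₁ : ℝ, (∀ z, Real.sqrt (∑ j : Fin 2, ∑ k : Fin 2, ‖(divB (torusT (PV 2 ℓ m K hd3 hL) 0) (fun κ z => unitsField (toUField W) ⟨z, κ⟩) (fun μ => covD (torusT (PV 2 ℓ m K hd3 hL) 0) (fun κ z => unitsField (toUField W) ⟨z, κ⟩) μ φ) z) j k‖ ^ 2) ≤ s₁) →
          ∀ (μ : Fin (PV 2 ℓ m K hd3 hL).d) (x : Site (PV 2 ℓ m K hd3 hL) 0),
            Real.sqrt (∑ j : Fin 2, ∑ k : Fin 2, ‖(covD (torusT (PV 2 ℓ m K hd3 hL) 0) (fun κ z => unitsField (toUField W) ⟨z, κ⟩) μ (fun y => φ y - φH y) x) j k‖ ^ 2) ≤ (cK * ((ℓ + 1 : ℕ) : ℝ) ^ (K - n)) * s₁ := by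
  obtain ⟨c35, a₅P, hc35, ha₅P, HP⟩ := sqrt_sum_hs_le_of_regPr' (hL := hL) hℓ4
  obtain ⟨a₅G, α, C₀, ha₅G, hα, hC₀, HG⟩ := exists_member_gen0_half (hL := hL) hℓ4
  obtain ⟨C₁, hC₁, HPK⟩ := exists_gen1_package
  -- the Poincaré size constant `cA` and the Agmon rate `κA`
  have hcA0 : 0 ≤ Real.sqrt (2 * (4 * 2197 * (24 * 289 * 24576 * 46116) : ℝ) * ((2 : ℕ) : ℝ) ^ 2
      + 2 * ((4 * 2197 * (24 * 289 * 24576 * 46116) : ℝ) * ((2 : ℕ) : ℝ) ^ 2 * (6 + 24 * (c35 * a₅P * Real.exp (c35 * a₅P)) ^ 2)) ^ 2) := Real.sqrt_nonneg _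
  generalize hcA : Real.sqrt (2 * (4 * 2197 * (24 * 289 * 24576 * 46116) : ℝ) * ((2 : ℕ) : ℝ) ^ 2
      + 2 * ((4 * 2197 * (24 * 289 * 24576 * 46116) : ℝ) * ((2 : ℕ) : ℝ) ^ 2 * (6 + 24 * (c35 * a₅P * Real.exp (c35 * a₅P)) ^ 2)) ^ 2) = cA at hcA0
  have hκpos : (0 : ℝ) < min (1 / 4) (min (1 / (200 * Real.sqrt 3 * Real.sqrt cA + 1)) (1 / (600 * cA + 1))) :=
    lt_min (by norm_num) (lt_min (by positivity) (by positivity))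
  have hκone : min (1 / 4) (min (1 / (200 * Real.sqrt 3 * Real.sqrt cA + 1)) (1 / (600 * cA + 1))) ≤ (1 : ℝ) := (min_le_left _ _).trans (by norm_num)
  have hκ4 : min (1 / 4) (min (1 / (200 * Real.sqrt 3 * Real.sqrt cA + 1)) (1 / (600 * cA + 1))) ≤ (1 : ℝ) / 4 := min_le_left _ _
  have hκw₁ : min (1 / 4) (min (1 / (200 * Real.sqrt 3 * Real.sqrt cA + 1)) (1 / (600 * cA + 1))) ≤ 1 / (200 * Real.sqrt 3 * Real.sqrt cA + 1) :=
    (min_le_right _ _).trans (min_le_left _ _)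
  have hκw₂ : min (1 / 4) (min (1 / (200 * Real.sqrt 3 * Real.sqrt cA + 1)) (1 / (600 * cA + 1))) ≤ 1 / (600 * cA + 1) :=
    (min_le_right _ _).trans (min_le_right _ _)
  generalize hκA : min (1 / 4) (min (1 / (200 * Real.sqrt 3 * Real.sqrt cA + 1)) (1 / (600 * cA + 1))) = κA at hκpos hκone hκ4 hκw₁ hκw₂
  obtain ⟨c₀, hc₀, HG'⟩ := HG cA κA hcA0 hκpos hκone
  refine ⟨c35, min a₅P a₅G, c₀ + 3 * (Real.sqrt (2 : ℕ) * C₁ * (22341248 + 10648 * ((15624 + 1031184 * (1 + (10 * Real.sqrt 3 + 6) ^ 2)) + 3 * (76384 * (26 * α + 484 * α ^ 2) + 44 * α * (59024 + 57288 * (10 * Real.sqrt 3 + 6))))) + 3 * (5 / κA * Real.sqrt (5 / κA)) * Real.exp (11 * κA) * Real.sqrt (2 : ℕ) * C₁ * (104 * (3 * (76384 * (26 * α + 484 * α ^ 2) + 44 * α * (59024 + 57288 * (10 * Real.sqrt 3 + 6)))) + Real.sqrt (21296 * (15624 + 1031184 * (1 + (10 * Real.sqrt 3 + 6) ^ 2))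 ^ 2 + 2 * 1736 ^ 2 * 1928)) + 5 * (5 / κA * Real.sqrt (5 / κA)) * cA * Real.exp (11 * κA) * Real.sqrt (2 : ℕ) * (C₁ * Real.sqrt (2801520 * (3 * (92 * α + 484 * α ^ 2)) ^ 2 + 60496128 * α ^ 2) + Real.sqrt (32000 * 1737 ^ 2 + 4085178624 * C₁ ^ 2))) * ((32 * α + 400 * α ^ 2) * C₀) + 1, hc35, lt_min ha₅P ha₅G, by positivity, ?_⟩
  intro hℓ m hm n K a' Rc hk1 hsize hM8 hR2 α₀ hα₀ hα1 hMα W hreg hwin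
  have hMαP : ((ℓ + 1 : ℕ) : ℝ) * (((ℓ + 1) ^ a' : ℕ) : ℝ) * α₀ ≤ a₅P := hMα.trans (min_le_left _ _)
  have hMαG : ((ℓ + 1 : ℕ) : ℝ) * (((ℓ + 1) ^ a' : ℕ) : ℝ) * α₀ ≤ a₅G := hMα.trans (min_le_right _ _)
  -- letters
  have hd : (PV 2 ℓ m K hd3 hL).d = 3 := rfl
  have hLdef : (PV 2 ℓ m K hd3 hL).L = ℓ + 1 := rfl
  have hk : K - n ≤ (PV 2 ℓ m K hd3 hL).m + (PV 2 ℓ m K hd3 hL).K := hkw ℓ hL m n K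
  have h3 : 3 ≤ (PV 2 ℓ m K hd3 hL).L ^ (K - n) := by
    rw [hLdef]
    have : ℓ + 1 ≤ (ℓ + 1) ^ (K - n) := Nat.le_self_pow (by omega) _
    omega
  have hℓk1 : (1 : ℝ) ≤ ((ℓ + 1 : ℕ) : ℝ) ^ (K - n) := one_le_pow₀ (by exact_mod_cast (show 1 ≤ ℓ + 1 by omega))
  have hℓk0 : (0 : ℝ) < ((ℓ + 1 : ℕ) : ℝ) ^ (K - n) := by linarith
  -- px4's Poincaré row and the size of its constant
  have hPmem := HP hℓ m hm n K a' Rc hk1 hsize hM8 hR2 α₀ hα₀ hMαP W hreg hwin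
  have hMnn : 0 ≤ c35 * (((ℓ + 1 : ℕ) : ℝ) * (((ℓ + 1) ^ a' : ℕ) : ℝ)) * α₀ := by positivity
  have hM1 : c35 * (((ℓ + 1 : ℕ) : ℝ) * (((ℓ + 1) ^ a' : ℕ) : ℝ)) * α₀ ≤ c35 * a₅P := by
    have h' := mul_le_mul_of_nonneg_left hMαP hc35.le
    have e : c35 * (((ℓ + 1 : ℕ) : ℝ) * (((ℓ + 1) ^ a' : ℕ) : ℝ)) * α₀ = c35 * (((ℓ + 1 : ℕ) : ℝ) * (((ℓ + 1) ^ a' : ℕ) : ℝ) * α₀) := by ring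
    rw [e]; exact h'
  have hinv1 : ((((ℓ + 1 : ℕ) : ℝ) ^ (K - n)))⁻¹ ≤ 1 := inv_le_one_of_one_le₀ hℓk1
  have hexp : Real.exp (((((ℓ + 1 : ℕ) : ℝ) ^ (K - n)))⁻¹ * (c35 * (((ℓ + 1 : ℕ) : ℝ) * (((ℓ + 1) ^ a' : ℕ) : ℝ)) * α₀)) ≤ Real.exp (c35 * a₅P) := by
    refine Real.exp_le_exp.2 ?_
    have h' : ((((ℓ + 1 : ℕ) : ℝ) ^ (K - n)))⁻¹ * (c35 * (((ℓ + 1 : ℕ) : ℝ) * (((ℓ + 1) ^ a' : ℕ) : ℝ)) * α₀) ≤ 1 * (c35 * (((ℓ + 1 : ℕ) : ℝ) * (((ℓ + 1) ^ a' : ℕ) : ℝ)) * α₀) :=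
      mul_le_mul_of_nonneg_right hinv1 hMnn
    linarith
  have hτ0 : 0 ≤ ((((ℓ + 1 : ℕ) : ℝ) ^ (K - n)))⁻¹ * (c35 * (((ℓ + 1 : ℕ) : ℝ) * (((ℓ + 1) ^ a' : ℕ) : ℝ)) * α₀)
      * Real.exp (((((ℓ + 1 : ℕ) : ℝ) ^ (K - n)))⁻¹ * (c35 * (((ℓ + 1 : ℕ) : ℝ) * (((ℓ + 1) ^ a' : ℕ) : ℝ)) * α₀)) := by positivity
  have hτ : ((((ℓ + 1 : ℕ) : ℝ) ^ (K - n)))⁻¹ * (c35 * (((ℓ + 1 : ℕ) : ℝ) * (((ℓ + 1) ^ a' : ℕ) : ℝ)) * α₀)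
      * Real.exp (((((ℓ + 1 : ℕ) : ℝ) ^ (K - n)))⁻¹ * (c35 * (((ℓ + 1 : ℕ) : ℝ) * (((ℓ + 1) ^ a' : ℕ) : ℝ)) * α₀)) * ((((PV 2 ℓ m K hd3 hL).L : ℝ)) ^ (K - n))
        ≤ c35 * a₅P * Real.exp (c35 * a₅P) := by
    have e : ((((ℓ + 1 : ℕ) : ℝ) ^ (K - n)))⁻¹ * (c35 * (((ℓ + 1 : ℕ) : ℝ) * (((ℓ + 1) ^ a' : ℕ) : ℝ)) * α₀)
        * Real.exp (((((ℓ + 1 : ℕ) : ℝ) ^ (K - n)))⁻¹ * (c35 * (((ℓ + 1 : ℕ) : ℝ) * (((ℓ + 1) ^ a' : ℕ) : ℝ)) * α₀)) * ((((PV 2 ℓ m K hd3 hL).L : ℝ)) ^ (K - n))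
        = (c35 * (((ℓ + 1 : ℕ) : ℝ) * (((ℓ + 1) ^ a' : ℕ) : ℝ)) * α₀)
          * Real.exp (((((ℓ + 1 : ℕ) : ℝ) ^ (K - n)))⁻¹ * (c35 * (((ℓ + 1 : ℕ) : ℝ) * (((ℓ + 1) ^ a' : ℕ) : ℝ)) * α₀)) := by
      rw [hLdef]
      field_simp
    rw [e]
    exact mul_le_mul hM1 hexp (Real.exp_pos _).le (by positivity)
  have hAsz := poincare_const_le (Kc := (4 * 2197 * (24 * 289 * 24576 * 46116) : ℝ)) (q := ((2 : ℕ) : ℝ) ^ 2) (L := (((PV 2 ℓ m K hd3 hL).L : ℝ))) (k := K - n) (α₀ := α₀)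
    (τ₁ := ((((ℓ + 1 : ℕ) : ℝ) ^ (K - n)))⁻¹ * (c35 * (((ℓ + 1 : ℕ) : ℝ) * (((ℓ + 1) ^ a' : ℕ) : ℝ)) * α₀)
      * Real.exp (((((ℓ + 1 : ℕ) : ℝ) ^ (K - n)))⁻¹ * (c35 * (((ℓ + 1 : ℕ) : ℝ) * (((ℓ + 1) ^ a' : ℕ) : ℝ)) * α₀)))
    (t := c35 * a₅P * Real.exp (c35 * a₅P)) hd (by norm_num) (by positivity) (by rw [hLdef]; exact_mod_cast (show 1 ≤ ℓ + 1 by omega)) hα₀.le hα1 hτ0 hτ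
  rw [hcA] at hAsz
  -- the windows of the Agmon rate
  have hd3r : (((⟨ℓ + 1, hL, m, hm⟩ : T3Family).P K).d : ℝ) = 3 := by norm_num [T3Family.P_d]
  have ha0 : (0 : ℝ) ≤ 2 * κA / (((ℓ + 1 : ℕ) : ℝ) ^ (K - n)) := by positivity
  have hb0 : (0 : ℝ) ≤ 4 * κA / (((ℓ + 1 : ℕ) : ℝ) ^ (K - n)) ^ 2 := by positivity
  have ha : 2 * κA / (((ℓ + 1 : ℕ) : ℝ) ^ (K - n)) ≤ 1 / 2 := by
    rw [div_le_iff₀ hℓk0]; linarith only [hκ4, hℓk1]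
  have hsA := Real.sqrt_le_sqrt hAsz
  rw [Real.sqrt_mul hcA0, Real.sqrt_sq (by positivity)] at hsA
  have hwin₁ : 2 * κA / (((ℓ + 1 : ℕ) : ℝ) ^ (K - n)) * Real.sqrt (((⟨ℓ + 1, hL, m, hm⟩ : T3Family).P K).d : ℝ)
      * Real.sqrt (Real.sqrt (2 * ((4 * 2197 * (24 * 289 * 24576 * 46116) : ℝ) * ((2 : ℕ) : ℝ) ^ 2 * ((((PV 2 ℓ m K hd3 hL).L : ℝ)) ^ (K - n)) ^ 4
                    + ((4 * 2197 * (24 * 289 * 24576 * 46116) : ℝ) * ((2 : ℕ) : ℝ) ^ 2 * ((((PV 2 ℓ m K hd3 hL).L : ℝ)) ^ (K - n)) ^ 4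
                      * (2 * (PV 2 ℓ m K hd3 hL).d * (α₀ * ((((PV 2 ℓ m K hd3 hL).L : ℝ))⁻¹) ^ (2 * (K - n))) + 8 * (PV 2 ℓ m K hd3 hL).d
                        * ((((ℓ + 1 : ℕ) : ℝ) ^ (K - n))⁻¹ * (c35 * (((ℓ + 1 : ℕ) : ℝ) * (((ℓ + 1) ^ a' : ℕ) : ℝ)) * α₀)
                          * Real.exp ((((ℓ + 1 : ℕ) : ℝ) ^ (K - n))⁻¹ * (c35 * (((ℓ + 1 : ℕ) : ℝ) * (((ℓ + 1) ^ a' : ℕ) : ℝ)) * α₀))) ^ 2)) ^ 2))) ≤ 1 / 100 := by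
    rw [hd3r]
    have hs3 : 0 ≤ Real.sqrt 3 := Real.sqrt_nonneg _
    have hsc : 0 ≤ Real.sqrt cA := Real.sqrt_nonneg _
    have h1 : 2 * κA / (((ℓ + 1 : ℕ) : ℝ) ^ (K - n)) * Real.sqrt 3 * (Real.sqrt cA * ((((PV 2 ℓ m K hd3 hL).L : ℝ)) ^ (K - n))) = 2 * κA * Real.sqrt 3 * Real.sqrt cA := by
      rw [hLdef]
      field_simp
    have h2 : κA * (200 * Real.sqrt 3 * Real.sqrt cA + 1) ≤ 1 := by
      have hpos : 0 < 200 * Real.sqrt 3 * Real.sqrt cA + 1 := by positivity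
      have := (le_div_iff₀ hpos).1 hκw₁
      linarith
    calc 2 * κA / (((ℓ + 1 : ℕ) : ℝ) ^ (K - n)) * Real.sqrt 3 * Real.sqrt _
        ≤ 2 * κA / (((ℓ + 1 : ℕ) : ℝ) ^ (K - n)) * Real.sqrt 3 * (Real.sqrt cA * ((((PV 2 ℓ m K hd3 hL).L : ℝ)) ^ (K - n))) :=
          mul_le_mul_of_nonneg_left hsA (by positivity)
      _ = 2 * κA * Real.sqrt 3 * Real.sqrt cA := h1
      _ ≤ 1 / 100 := by
          have h3 : κA * (200 * Real.sqrt 3 * Real.sqrt cA + 1) = 100 * (2 * κA * Real.sqrt 3 * Real.sqrt cA) + κA := by ring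
          linarith only [h2, h3, hκpos.le]
  have hwin₂ : 4 * κA / (((ℓ + 1 : ℕ) : ℝ) ^ (K - n)) ^ 2 * (((⟨ℓ + 1, hL, m, hm⟩ : T3Family).P K).d : ℝ)
      * Real.sqrt (2 * ((4 * 2197 * (24 * 289 * 24576 * 46116) : ℝ) * ((2 : ℕ) : ℝ) ^ 2 * ((((PV 2 ℓ m K hd3 hL).L : ℝ)) ^ (K - n)) ^ 4
                    + ((4 * 2197 * (24 * 289 * 24576 * 46116) : ℝ) * ((2 : ℕ) : ℝ) ^ 2 * ((((PV 2 ℓ m K hd3 hL).L : ℝ)) ^ (K - n)) ^ 4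
                      * (2 * (PV 2 ℓ m K hd3 hL).d * (α₀ * ((((PV 2 ℓ m K hd3 hL).L : ℝ))⁻¹) ^ (2 * (K - n))) + 8 * (PV 2 ℓ m K hd3 hL).d
                        * ((((ℓ + 1 : ℕ) : ℝ) ^ (K - n))⁻¹ * (c35 * (((ℓ + 1 : ℕ) : ℝ) * (((ℓ + 1) ^ a' : ℕ) : ℝ)) * α₀)
                          * Real.exp ((((ℓ + 1 : ℕ) : ℝ) ^ (K - n))⁻¹ * (c35 * (((ℓ + 1 : ℕ) : ℝ) * (((ℓ + 1) ^ a' : ℕ) : ℝ)) * α₀))) ^ 2)) ^ 2)) ≤ 1 / 50 := by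
    rw [hd3r]
    have h1 : 4 * κA / (((ℓ + 1 : ℕ) : ℝ) ^ (K - n)) ^ 2 * 3 * (cA * ((((PV 2 ℓ m K hd3 hL).L : ℝ)) ^ (K - n)) ^ 2) = 12 * κA * cA := by
      rw [hLdef]
      field_simp
      ring
    have h2 : κA * (600 * cA + 1) ≤ 1 := by
      have hpos : 0 < 600 * cA + 1 := by positivity
      have := (le_div_iff₀ hpos).1 hκw₂
      linarith
    calc 4 * κA / (((ℓ + 1 : ℕ) : ℝ) ^ (K - n)) ^ 2 * 3 * _
        ≤ 4 * κA / (((ℓ + 1 : ℕ) : ℝ) ^ (K - n)) ^ 2 * 3 * (cA * ((((PV 2 ℓ m K hd3 hL).L : ℝ)) ^ (K - n)) ^ 2) := mul_le_mul_of_nonneg_left hAsz (by positivity)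
      _ = 12 * κA * cA := h1
      _ ≤ 1 / 50 := by
          have h3 : κA * (600 * cA + 1) = 50 * (12 * κA * cA) + κA := by ring
          linarith only [h2, h3, hκpos.le]
  have hκf : (0 : ℝ) ≤ (c₀ + 3 * (Real.sqrt (2 : ℕ) * C₁ * (22341248 + 10648 * ((15624 + 1031184 * (1 + (10 * Real.sqrt 3 + 6) ^ 2)) + 3 * (76384 * (26 * α + 484 * α ^ 2) + 44 * α * (59024 + 57288 * (10 * Real.sqrt 3 + 6))))) + 3 * (5 / κA * Real.sqrt (5 / κA)) * Real.exp (11 * κA) * Real.sqrt (2 : ℕ) * C₁ * (104 * (3 * (76384 * (26 * α + 484 * α ^ 2) + 44 * α * (59024 + 57288 * (10 * Real.sqrt 3 + 6)))) + Real.sqrt (21296 * (15624 + 1031184 * (1 + (10 * Real.sqrt 3 + 6) ^ 2)) ^ 2 + 2 * 1736 ^ 2 * 1928)) + 5 * (5 / κA * Real.sqrt (5 / κA)) * cA * Real.exp (11 * κA) * Real.sqrt (2 : ℕ) * (C₁ * Real.sqrt (2801520 * (3 * (92 * α + 484 * α ^ 2)) ^ 2 + 60496128 * α ^ 2) + Real.sqrt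 (32000 * 1737 ^ 2 + 4085178624 * C₁ ^ 2))) * ((32 * α + 400 * α ^ 2) * C₀) + 1) * ((ℓ + 1 : ℕ) : ℝ) ^ (K - n) := by positivity
  -- ✓p680753 `hKsup_of_transplant_T3'`
  refine hKsup_of_transplant_T3' (⟨ℓ + 1, hL, m, hm⟩ : T3Family) K n W ha0 hb0 (Real.sqrt_nonneg _) hPmem ha hwin₁ hwin₂ hκf ?_
  intro μ x
  obtain ⟨Fr, ω, A₀, A₁, A₂, hU, hFr, hFr1, hpole, hA₀0, hA₁0, hA₂0, h1, h1', h2, hA₁, hA₀, hA₂, hω₀, hω₁, hω₂, hcount, hωS, HX⟩ :=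
    HG' hℓ m hm n K a' Rc hk1 hsize hM8 hR2 α₀ hα₀ hMαG W hreg x
  refine ⟨ω, 5 / κA * Real.sqrt (5 / κA) * (((ℓ + 1 : ℕ) : ℝ) ^ (K - n)) * Real.sqrt (((ℓ + 1 : ℕ) : ℝ) ^ (K - n)), hω₀, hω₁, hω₂, hcount, fun X => ?_⟩
  obtain ⟨ψ, g, c₁, c₂, ψt, N2₀, N3₀, N4₀, H₀, S₀, hid1, hid2, hψt, hN2₀, hH₀, hS₀, hN3₀, hN4₀, hE2, hB, htot₀⟩ := HX μ X
  -- the gen-1 package on the density `E₂`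
  have hΩ0 : (0 : ℝ) ≤ Real.exp (11 * κA) := (Real.exp_pos _).le
  obtain ⟨hE₂S, hE₂0⟩ := hE2 (fun z => divB (torusT (PV 2 ℓ m K hd3 hL) 0) (fun κ z => unitsField (toUField W) ⟨z, κ⟩)
      (fun μ => covD (torusT (PV 2 ℓ m K hd3 hL) 0) (fun κ z => unitsField (toUField W) ⟨z, κ⟩) μ (fun y => g y • R (Fr y) X)) z
    - (∑ ν : Fin (PV 2 ℓ m K hd3 hL).d, (2 * g z - g (torusT (PV 2 ℓ m K hd3 hL) 0 ν z) - g ((torusT (PV 2 ℓ m K hd3 hL) 0 ν).symm z))) • R (Fr z) X) (fun z => rfl)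
  have hD0 : (0 : ℝ) ≤ ((PV 2 ℓ m K hd3 hL).d : ℝ) * (((2 * (A₀ + A₂ * (9 * (((PV 2 ℓ m K hd3 hL).L ^ (K - n) : ℕ) : ℝ) + 2)) + 4 * (A₁ * (9 * (((PV 2 ℓ m K hd3 hL).L ^ (K - n) : ℕ) : ℝ) + 1)) ^ 2) * C₀
      + 8 * A₁ * C₀)) * ‖X‖ := by positivity
  have hE₂D : ∀ z ∈ (univ.filter fun z : Site (PV 2 ℓ m K hd3 hL) 0 => Site.tdist z x ≤ 9 * (PV 2 ℓ m K hd3 hL).L ^ (K - n)),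
      ‖(divB (torusT (PV 2 ℓ m K hd3 hL) 0) (fun κ z => unitsField (toUField W) ⟨z, κ⟩)
          (fun μ => covD (torusT (PV 2 ℓ m K hd3 hL) 0) (fun κ z => unitsField (toUField W) ⟨z, κ⟩) μ (fun y => g y • R (Fr y) X)) z
        - (∑ ν : Fin (PV 2 ℓ m K hd3 hL).d, (2 * g z - g (torusT (PV 2 ℓ m K hd3 hL) 0 ν z) - g ((torusT (PV 2 ℓ m K hd3 hL) 0 ν).symm z))) • R (Fr z) X)‖
        ≤ ((PV 2 ℓ m K hd3 hL).d : ℝ) * (((2 * (A₀ + A₂ * (9 * (((PV 2 ℓ m K hd3 hL).L ^ (K - n) : ℕ) : ℝ) + 2)) + 4 * (A₁ * (9 * (((PV 2 ℓ m K hd3 hL).L ^ (K - n) : ℕ) : ℝ) + 1)) ^ 2) * C₀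
            + 8 * A₁ * C₀)) * ‖X‖ / (max 1 ((Site.tdist z x : ℕ) : ℝ)) ^ 2 := by
    intro z hz
    have e : ((PV 2 ℓ m K hd3 hL).d : ℝ) * (((2 * (A₀ + A₂ * (9 * (((PV 2 ℓ m K hd3 hL).L ^ (K - n) : ℕ) : ℝ) + 2)) + 4 * (A₁ * (9 * (((PV 2 ℓ m K hd3 hL).L ^ (K - n) : ℕ) : ℝ) + 1)) ^ 2) * C₀
            + 8 * A₁ * C₀)) * ‖X‖ / (max 1 ((Site.tdist z x : ℕ) : ℝ)) ^ 2
        = ((PV 2 ℓ m K hd3 hL).d : ℝ) * ((((2 * (A₀ + A₂ * (9 * (((PV 2 ℓ m K hd3 hL).L ^ (K - n) : ℕ) : ℝ) + 2)) + 4 * (A₁ * (9 * (((PV 2 ℓ m K hd3 hL).L ^ (K - n) : ℕ) : ℝ) + 1)) ^ 2) * C₀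
            + 8 * A₁ * C₀)) / (max 1 ((Site.tdist z x : ℕ) : ℝ)) ^ 2) * ‖X‖ := by ring
    rw [e]; exact hE₂S z hz
  obtain ⟨F, F', c₁', c₂', J, hJ, hFsplit, hF', hu₁, hN2₁, ⟨hN3₁, hN4₁⟩, hH₁, hS₁⟩ :=
    HPK (PV 2 ℓ m K hd3 hL) hd (K - n) hk h3 x (fun κ z => unitsField (toUField W) ⟨z, κ⟩) Fr hU hFr A₀ A₁ A₂ hA₀0 hA₁0 hA₂0 h1 h1' h2 ω (Real.exp (11 * κA)) hΩ0 hωS _ _ hD0 hE₂D hE₂0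
  refine htr_body_of_rows''' (fun κ z => unitsField (toUField W) ⟨z, κ⟩) Fr (Set.range (embIter (P := PV 2 ℓ m K hd3 hL) (K - n))) x μ X hFr1 (hpole μ)
    ψ g c₁ c₂ ψt hid1 hid2 hψt F F' c₁' c₂' J (fun _ => 0)
    (fun z => divB (torusT (PV 2 ℓ m K hd3 hL) 0) (fun κ z => unitsField (toUField W) ⟨z, κ⟩)
        (fun μ => covD (torusT (PV 2 ℓ m K hd3 hL) 0) (fun κ z => unitsField (toUField W) ⟨z, κ⟩) μ (fun y => ψ y • R (Fr y) X)) z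
      - (∑ ν : Fin (PV 2 ℓ m K hd3 hL).d, (2 * ψ z - ψ (torusT (PV 2 ℓ m K hd3 hL) 0 ν z) - ψ ((torusT (PV 2 ℓ m K hd3 hL) 0 ν).symm z))) • R (Fr z) X)
    (fun z => divB (torusT (PV 2 ℓ m K hd3 hL) 0) (fun κ z => unitsField (toUField W) ⟨z, κ⟩)
        (fun μ => covD (torusT (PV 2 ℓ m K hd3 hL) 0) (fun κ z => unitsField (toUField W) ⟨z, κ⟩) μ (fun y => g y • R (Fr y) X)) z
      - (∑ ν : Fin (PV 2 ℓ m K hd3 hL).d, (2 * g z - g (torusT (PV 2 ℓ m K hd3 hL) 0 ν z) - g ((torusT (PV 2 ℓ m K hd3 hL) 0 ν).symm z))) • R (Fr z) X)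
    (fun z => divB (torusT (PV 2 ℓ m K hd3 hL) 0) (fun κ z => unitsField (toUField W) ⟨z, κ⟩)
        (fun μ => covD (torusT (PV 2 ℓ m K hd3 hL) 0) (fun κ z => unitsField (toUField W) ⟨z, κ⟩) μ (fun y => R (Fr y) (F y))) z
      - R (Fr z) (∑ μ : Fin (PV 2 ℓ m K hd3 hL).d, ((F z - F (torusT (PV 2 ℓ m K hd3 hL) 0 μ z)) + (F z - F ((torusT (PV 2 ℓ m K hd3 hL) 0 μ).symm z)))))
    (fun z => divB (torusT (PV 2 ℓ m K hd3 hL) 0) (fun κ z => unitsField (toUField W) ⟨z, κ⟩)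
        (fun μ => covD (torusT (PV 2 ℓ m K hd3 hL) 0) (fun κ z => unitsField (toUField W) ⟨z, κ⟩) μ (fun y => R (Fr y) (F' y))) z
      - R (Fr z) (∑ ν : Fin (PV 2 ℓ m K hd3 hL).d, ((F' z - F' (torusT (PV 2 ℓ m K hd3 hL) 0 ν z)) + (F' z - F' ((torusT (PV 2 ℓ m K hd3 hL) 0 ν).symm z)))))
    (fun _ => 0) (fun z => rfl) (fun z => rfl) (fun z => rfl) hFsplit (fun z => rfl) hF' hJ (fun z _ => rfl) hu₁ ω
    hN2₀ hN2₁ hN3₀ hN3₁ hN4₀ hN4₁ (hH₀ _ fun z => rfl) (hH₁ _ fun z => rfl) hS₀ (hS₁ _ fun z => rfl) ?_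
  -- `htot`: the gen-0 half (✓ `exists_member_gen0_half`) + the gen-1 half (px11 ✓ `gen1_total_le`) + the size of `D·ℓ²`
  have e₁ : (((PV 2 ℓ m K hd3 hL).L ^ (K - n) : ℕ) : ℝ) = (((PV 2 ℓ m K hd3 hL).L : ℕ) : ℝ) ^ (K - n) := Nat.cast_pow _ _
  have e₂ : (((PV 2 ℓ m K hd3 hL).L ^ (K - n) : ℕ) : ℝ) = ((ℓ + 1 : ℕ) : ℝ) ^ (K - n) := by rw [hLdef]; exact Nat.cast_pow _ _
  have eℓ : ((((PV 2 ℓ m K hd3 hL).L : ℝ)) ^ (K - n)) = ((ℓ + 1 : ℕ) : ℝ) ^ (K - n) := by rw [hLdef]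
  have hdr : ((PV 2 ℓ m K hd3 hL).d : ℝ) = 3 := by rw [hd]; norm_num
  have h3r : (3 : ℝ) ≤ (((PV 2 ℓ m K hd3 hL).L : ℕ) : ℝ) ^ (K - n) := by rw [← e₁]; exact_mod_cast h3
  have hr9 : ((9 * (PV 2 ℓ m K hd3 hL).L ^ (K - n) : ℕ) : ℝ) = 9 * (((PV 2 ℓ m K hd3 hL).L : ℕ) : ℝ) ^ (K - n) := by
    rw [Nat.cast_mul, Nat.cast_pow, Nat.cast_ofNat]
  have hr45 : ((45 * (PV 2 ℓ m K hd3 hL).L ^ (K - n) : ℕ) : ℝ) = 45 * (((PV 2 ℓ m K hd3 hL).L : ℕ) : ℝ) ^ (K - n) := by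
    rw [Nat.cast_mul, Nat.cast_pow, Nat.cast_ofNat]
  have hr10 : ((9 * (PV 2 ℓ m K hd3 hL).L ^ (K - n) + (PV 2 ℓ m K hd3 hL).L ^ (K - n) : ℕ) : ℝ)
      = 9 * (((PV 2 ℓ m K hd3 hL).L : ℕ) : ℝ) ^ (K - n) + (((PV 2 ℓ m K hd3 hL).L : ℕ) : ℝ) ^ (K - n) := by
    rw [Nat.cast_add, Nat.cast_mul, Nat.cast_pow, Nat.cast_ofNat]
  have hLT : (((PV 2 ℓ m K hd3 hL).L : ℕ) : ℝ) ^ (K - n) ≤ (((PV 2 ℓ m K hd3 hL).L ^ (K - n) * (PV 2 ℓ m K hd3 hL).sitesPerDir (K - n) : ℕ) : ℝ) := by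
    have h' : (PV 2 ℓ m K hd3 hL).L ^ (K - n) ≤ (PV 2 ℓ m K hd3 hL).L ^ (K - n) * (PV 2 ℓ m K hd3 hL).sitesPerDir (K - n) :=
      Nat.le_mul_of_pos_right _ (Nat.pos_of_ne_zero ((PV 2 ℓ m K hd3 hL).sitesPerDir_ne_zero (K - n)))
    exact_mod_cast h'
  have hcard := card_ball_le (P := PV 2 ℓ m K hd3 hL) x ((PV 2 ℓ m K hd3 hL).L ^ (K - n))
  have hcard' := card_ball_le' (P := PV 2 ℓ m K hd3 hL) x ((PV 2 ℓ m K hd3 hL).L ^ (K - n)) (K - n)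
  have hw0 : (0 : ℝ) ≤ 5 / κA * Real.sqrt (5 / κA) := by positivity
  have hnX := norm_le_sqrt_hs X
  have hrX0 : 0 ≤ Real.sqrt (∑ j : Fin 2, ∑ k : Fin 2, ‖X j k‖ ^ 2) := Real.sqrt_nonneg _
  refine htot_of_halves (htot₀ _ (Real.sqrt_nonneg _) hAsz)
    (gen1_total_le (d := (PV 2 ℓ m K hd3 hL).d) hd 2 (ℓ₁ := (((PV 2 ℓ m K hd3 hL).L ^ (K - n) : ℕ) : ℝ)) (ℓ := (((PV 2 ℓ m K hd3 hL).L : ℕ) : ℝ) ^ (K - n))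
      (r9 := ((9 * (PV 2 ℓ m K hd3 hL).L ^ (K - n) : ℕ) : ℝ)) (r45 := ((45 * (PV 2 ℓ m K hd3 hL).L ^ (K - n) : ℕ) : ℝ))
      (r10 := ((9 * (PV 2 ℓ m K hd3 hL).L ^ (K - n) + (PV 2 ℓ m K hd3 hL).L ^ (K - n) : ℕ) : ℝ))
      (LT := (((PV 2 ℓ m K hd3 hL).L ^ (K - n) * (PV 2 ℓ m K hd3 hL).sitesPerDir (K - n) : ℕ) : ℝ))
      (card := (((univ.filter fun z : Site (PV 2 ℓ m K hd3 hL) 0 => Site.tdist z x ≤ 9 * (PV 2 ℓ m K hd3 hL).L ^ (K - n))).card : ℝ))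
      (card' := (((univ.filter fun z : Site (PV 2 ℓ m K hd3 hL) 0 => Site.tdist z x ≤ 9 * (PV 2 ℓ m K hd3 hL).L ^ (K - n) + (PV 2 ℓ m K hd3 hL).L ^ (K - n))).card : ℝ))
      e₁ h3r hr9 hr45 hr10 hLT hcard hcard' (C := C₁)
      (D := ((PV 2 ℓ m K hd3 hL).d : ℝ) * (((2 * (A₀ + A₂ * (9 * (((PV 2 ℓ m K hd3 hL).L ^ (K - n) : ℕ) : ℝ) + 2)) + 4 * (A₁ * (9 * (((PV 2 ℓ m K hd3 hL).L ^ (K - n) : ℕ) : ℝ) + 1)) ^ 2) * C₀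
        + 8 * A₁ * C₀)) * ‖X‖)
      (α := α) (Ω := Real.exp (11 * κA)) (W₀ := 5 / κA * Real.sqrt (5 / κA) * (((ℓ + 1 : ℕ) : ℝ) ^ (K - n)) * Real.sqrt (((ℓ + 1 : ℕ) : ℝ) ^ (K - n)))
      (w := 5 / κA * Real.sqrt (5 / κA)) (cA := cA) (A₀ := A₀) (A₁ := A₁) (A₂ := A₂)
      hC₁ hD0 hΩ0 hw0 hA₀0 hA₁0 hA₂0 hA₀ hA₁ hA₂ le_rfl (Real.sqrt_nonneg _) hAsz) ?_
  -- `c₀·ℓ_k·rX + c₁·ℓ_k·(D·ℓ_k²) ≤ c_K·ℓ_k·rX`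
  refine hg_of (by positivity) hℓk0.le hrX0 ?_
  rw [eℓ, hdr, e₂]
  rw [e₂] at hB
  have hα' : (0 : ℝ) ≤ (32 * α + 400 * α ^ 2) * C₀ := by positivity
  have e : (3 : ℝ) * (((2 * (A₀ + A₂ * (9 * (((ℓ + 1 : ℕ) : ℝ) ^ (K - n)) + 2)) + 4 * (A₁ * (9 * (((ℓ + 1 : ℕ) : ℝ) ^ (K - n)) + 1)) ^ 2) * C₀ + 8 * A₁ * C₀)) * ‖X‖
      * (((ℓ + 1 : ℕ) : ℝ) ^ (K - n)) ^ 2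
      = 3 * ((((2 * (A₀ + A₂ * (9 * (((ℓ + 1 : ℕ) : ℝ) ^ (K - n)) + 2)) + 4 * (A₁ * (9 * (((ℓ + 1 : ℕ) : ℝ) ^ (K - n)) + 1)) ^ 2) * C₀ + 8 * A₁ * C₀)
        * (((ℓ + 1 : ℕ) : ℝ) ^ (K - n)) ^ 2) * ‖X‖) := by ring
  rw [e, mul_assoc (3 : ℝ)]
  exact mul_le_mul_of_nonneg_left (mul_le_mul hB hnX (norm_nonneg X) hα') (by norm_num : (0 : ℝ) ≤ 3)

end Summit.QuantumFields.YangMills.Theorems.Prop7CovKernelMember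

end
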